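import Literature.IUT.HodgeTheaters.TemperedCoveringsCor23viGraphIncidence
import Literature.IUT.HodgeTheaters.StableCurveTemperedDataOfSpecialFibreCuspedPiDataNVExposed
import HarnessLib

/-!
# [IUTchI] Cor. 2.3 (vi) at the genuine datum, GROUP-form cusp atom: the closer FIRES WITH ZERO LAWS at abc-iut-L3's
# cusped `PiData` witness (node `IUTchI:Cor2.3(vi)`, split (B), token rule clause (b))

S. Mochizuki, *Inter-universal Teichmüller theory I*, kurims manuscript (May 2020), §2, Cor. 2.3 (vi) p. 48
[cite: Mochizuki2012, Cor 2.3(vi) p.48] (D-0012 claim key; nothing of the series is asserted here); S. Mochizuki,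
*Semi-graphs of anabelioids*, Publ. RIMS **42** (2006), Ex. 3.10 p. 44 (the special-fibre tower), Thm. 3.7 (iii) p. 41,
§6 p. 71 (`I_x ≅ Ẑ(1)`) [cite: MochizukiSemiAnbd2006, Ex 3.10 p.44].

PROOF-ONLY non-vacuity companion (abc-iut cell, seat abc-iut-L5-d5 gen 8; no definition, no instance, no new `Prop` fact)
of `TemperedCoveringsCor23viGraphIncidence.lean`, whose closer `cor23vi_ofSpecialFibre_verticialOver_of_verts_univ` proves
Cor. 2.3 (vi) AS TYPED at the genuine 𝔛-datum `ofSpecialFibre`, with the (vi)(b) atom in GROUP form ("`J_x` is verticial at a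
vertex of `ℍ`"), OUTRIGHT — no cusp law — whenever `ℍ` contains every vertex of the FINITE special fibre.  HERE that closer is
shown to FIRE at a datum the tree constructs: abc-iut-L3's cusped free-profinite `PiData` witness with exposed fibres
(`SpecialFibreTower.PiData.exists_temperedCurve_freeProfiniteTwo_cusped_exposed`: `Π^temp := G_{ℚ_p} × F̂₂`, ONE cusp with
`I_x ≅ Ẑ`, one-vertex special fibres, `FiniteLevels`), at `ℍ := P.H` (which contains the unique vertex, its base vertex) and
`Π^tp_ℍ := P.TpH` —

* `exists_cor23vi_verticialOver_lawfree` — THERE ARE `X`, `d`, `S`, `T`, `P : PiData X d S T` with a cusp such that, for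
  EVERY choice of prime sets `Σ ⊆ Σ̂` (`p ∉ Σ`) and of `h36`, Cor. 2.3 (vi) AS TYPED holds at
  `ofSpecialFibre X d S h36 Σ Σ̂ … P.TpH (closure ι(P.TpH)) _ (x ↦ J_x verticial over P.H)` — with NO law binder at all
  (contrast: the companion `TemperedCoveringsCor23viOfSpecialFibreNV.lean` of abc-iut-w4-d070 inhabits the two laws
  `{hcusp, hhatH}` of the vertex-atom closer at the same witness).

HONEST LIMITS (those of the witness): consistency evidence for OUR binders only — `Π^temp` is a profinite direct product (a
genuine `Π^tp_X` is neither), the special fibres are one-vertex semi-graphs WITHOUT edges (so the cusp ↦ open-edge dictionary of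
a genuine stable model is absent there and `ℍ ⊇ V(𝔾^c)` holds for the trivial reason); NOT André's `π₁^temp` of a curve; no
curve is asserted to realise the datum; at a genuine multi-component special fibre with `ℍ ⊉ V(𝔾^c)` the node still rests on
the profinite incidence `hhatV` (row «COR23VI-HATH-PROSIGMA»).  Nothing here bears on [IUTchIII] Cor. 3.12; typed ≠
inhabited ≠ discharged.
-/

noncomputable section

namespace Literature.IUT.HodgeTheaters

open scoped Pointwise
open Literature.AnabelianGeometry.SemiGraphs
open Literature.AnabelianGeometry.SemiGraphs.ProfiniteSemiGraph

namespace StableCurveTemperedData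

/-- **At abc-iut-L3's cusped `PiData` witness, `ℍ := P.H` contains every vertex and the base fibre is finite** (one vertex —
the base vertex of `ℍ` — and `FiniteLevels`), with a cusp present: exactly the inputs of the law-free closer.  Consistency
evidence only. [cite: MochizukiSemiAnbd2006, Ex 3.10 p.44] -/
theorem exists_piData_verts_univ (p : ℕ) [Fact p.Prime] :
    ∃ (X : TemperedCurve p) (d : X.GroupLevelData) (S : SpecialFibreData (X.toTemperedArithmeticGroup d))
      (T : SpecialFibreTower X.DeltaTemp) (P : SpecialFibreTower.PiData X d S T),
      Nonempty {x : X.Pt // X.IsCusp x} ∧ Finite S.Gc.graph.Vertex ∧ Finite S.Gc.graph.Edge ∧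
        ∀ v : S.Gc.graph.Vertex, v ∈ P.H.verts := by
  obtain ⟨X, d, S, T, -, -, ⟨x, hx⟩, -, -, -, -, hF, ⟨P⟩, -, ⟨-, -, -, ⟨hU⟩, -, -⟩, -⟩ :=
    SpecialFibreTower.PiData.exists_temperedCurve_freeProfiniteTwo_cusped_exposed p
  refine ⟨X, d, S, T, P, ⟨⟨x, hx⟩⟩, hF.finite_vertex_base, hF.finite_edge_base, fun v => ?_⟩
  haveI : Unique S.Gc.graph.Vertex := hU
  rw [Subsingleton.elim v P.baseVertex]
  exact P.baseVertex_mem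

/-- **The GROUP-atom (vi) closer FIRES WITH ZERO LAWS at that datum**: for any prime sets `Σ ⊆ Σ̂` with `p ∉ Σ` and any `h36`,
Cor. 2.3 (vi) AS TYPED holds at `ofSpecialFibre X d S h36 Σ Σ̂ … P.TpH (closure ι(P.TpH)) _ (x ↦ ∃ v ∈ P.H, J_x ≤ a verticial
subgroup at v)` for the witness's `X d S T P` — by `cor23vi_ofSpecialFibre_verticialOver_of_verts_univ` (finite fibre, `ℍ ⊇
V(𝔾^c)`, `P.TpH_verticial`); no `hcusp`, no `hhatH`, no `hhatV`.  Consistency evidence only; FQ type per the gate rule.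
[cite: Mochizuki2012, Cor 2.3(vi) p.48] [claim: Mochizuki2012, status: disputed] -/
theorem exists_cor23vi_verticialOver_lawfree (p : ℕ) [Fact p.Prime] :
    ∃ (X : TemperedCurve p) (d : X.GroupLevelData) (S : SpecialFibreData (X.toTemperedArithmeticGroup d))
      (T : SpecialFibreTower X.DeltaTemp) (P : SpecialFibreTower.PiData X d S T),
      Nonempty {x : X.Pt // X.IsCusp x} ∧
      ∀ (h36 : S.Gc.Prop36Hypotheses) (Sigma SigmaHat : Set ℕ) (hsub : Sigma ⊆ SigmaHat) (hne : Sigma.Nonempty)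
        (hprime : ∀ q ∈ SigmaHat, q.Prime) (hp : p ∉ Sigma),
        Literature.IUT.HodgeTheaters.StableCurveTemperedData.Cor23vi
          (ofSpecialFibre X d S h36 Sigma SigmaHat hsub hne hprime hp P.TpH ((P.TpH.map
            (TemperedGraphGroupData.exists_completion_of_prop36 S.Gc h36 S.chart).choose_spec.choose.toMonoidHom
            ).topologicalClosure) (Subgroup.le_topologicalClosure _)
            (fun x => ∃ v ∈ P.H.verts, ∃ K ∈ verticialSubgroups S.chart v,
              ((X.inertia x.1).subgroupOf (X.toTemperedArithmeticGroup d).delta).map S.admissible.toMonoidHom ≤ K)) := by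
  obtain ⟨X, d, S, T, P, hx, hV, hE, hall⟩ := exists_piData_verts_univ p
  exact ⟨X, d, S, T, P, hx, fun h36 Sigma SigmaHat hsub hne hprime hp =>
    cor23vi_ofSpecialFibre_verticialOver_of_verts_univ X d S h36 Sigma SigmaHat hsub hne hprime hp P.TpH hV hE hall
      P.TpH_verticial⟩

/-- The same with the special fibre's OWN Prop. 3.6 bundle `h36 := S.hyp.toProp36Hypotheses` (no free hypothesis left besides
the prime-set labels).  Consistency evidence only. [cite: Mochizuki2012, Cor 2.3(vi) p.48] [claim: Mochizuki2012, status: disputed] -/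
theorem exists_cor23vi_verticialOver_lawfree_hyp (p : ℕ) [Fact p.Prime] (Sigma SigmaHat : Set ℕ)
    (hsub : Sigma ⊆ SigmaHat) (hne : Sigma.Nonempty) (hprime : ∀ q ∈ SigmaHat, q.Prime) (hp : p ∉ Sigma) :
    ∃ (X : TemperedCurve p) (d : X.GroupLevelData) (S : SpecialFibreData (X.toTemperedArithmeticGroup d))
      (T : SpecialFibreTower X.DeltaTemp) (P : SpecialFibreTower.PiData X d S T) (h36 : S.Gc.Prop36Hypotheses),
      Nonempty {x : X.Pt // X.IsCusp x} ∧
        Literature.IUT.HodgeTheaters.StableCurveTemperedData.Cor23vi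
          (ofSpecialFibre X d S h36 Sigma SigmaHat hsub hne hprime hp P.TpH ((P.TpH.map
            (TemperedGraphGroupData.exists_completion_of_prop36 S.Gc h36 S.chart).choose_spec.choose.toMonoidHom
            ).topologicalClosure) (Subgroup.le_topologicalClosure _)
            (fun x => ∃ v ∈ P.H.verts, ∃ K ∈ verticialSubgroups S.chart v,
              ((X.inertia x.1).subgroupOf (X.toTemperedArithmeticGroup d).delta).map S.admissible.toMonoidHom ≤ K)) := by
  obtain ⟨X, d, S, T, P, hx, h⟩ := exists_cor23vi_verticialOver_lawfree p
  exact ⟨X, d, S, T, P, S.hyp.toProp36Hypotheses, hx, h _ Sigma SigmaHat hsub hne hprime hp⟩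

end StableCurveTemperedData

end Literature.IUT.HodgeTheaters

end
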